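import Summits.AtomisticToContinuum.HydrodynamicLimit.Theses.SuperextensiveClosureCost
import HarnessLib

/-!
# Transfer bookkeeping for `WeakStrongToInBand` (support item stmt-AtomisticToContinuum-14428,
# route `SuperextensiveClosureCost`, sub-problem `HydrodynamicLimit`)

The probabilistic half of the route's glue is elementary: the static `L²` budget
(`TransferInequality`, inlined in `WeakStrongToInBand` as an antecedent)
`LG_N(S)² ≤ e^{C(N+1)} · G_N(S)` for every event `S`, combined with a superexponential bound
`G_N(S_N) ≤ e^{-M(N+1)}` eventually (the shape of the conclusions of `MomentumClosureCost` /
`EnergyClosureCost`, used with `M := C + 1`), forces `LG_N(S_N) → 0`; finitely many such bad events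
are then removed by a union bound. This file records exactly these steps, once for arbitrary
sequences in `ℝ≥0∞` / arbitrary sequences of measures, and once in the vocabulary of the route
(`localGibbsLaw σ a₀ u₀ θ₀` against the homogeneous law `localGibbsLaw σ 1 0 θe`).

References: C. Kipnis, C. Landim, *Scaling Limits of Interacting Particle Systems* (1999), Ch. 10,
§5 (Radon–Nikodym transfer of superexponential estimates); the Cauchy–Schwarz variant is the one of
the route text (`TransferInequality`).
-/

noncomputable section

namespace Summit.AtomisticToContinuum.HydrodynamicLimit.Theorems

open MeasureTheory Filter Topology
open scoped ENNReal
open Literature.Analysis.FluidPDE Literature.MathematicalPhysics.KineticTheory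

/-- **Exponential budget against superexponential smallness, in `ℝ≥0∞`.** If
`a N ^ 2 ≤ e^{C(N+1)} · b N` for all `N` and `b N ≤ e^{-M(N+1)}` eventually with `C < M`, then
`a N → 0`: indeed `a N ≤ e^{(C-M)(N+1)/2}`. [cite: KipnisLandim1999, Ch. 10 §5] -/
theorem ennreal_tendsto_zero_of_sq_le_exp_mul {a b : ℕ → ℝ≥0∞} {C M : ℝ} (hCM : C < M)
    (hab : ∀ N : ℕ, a N ^ 2 ≤ ENNReal.ofReal (Real.exp (C * (N + 1))) * b N)
    (hb : ∀ᶠ N : ℕ in atTop, b N ≤ ENNReal.ofReal (Real.exp (-(M * (N + 1))))) :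
    Tendsto a atTop (𝓝 0) := by
  -- the dominating sequence `d N = e^{(C-M)(N+1)/2}` tends to `0`
  set d : ℕ → ℝ≥0∞ := fun N => ENNReal.ofReal (Real.exp ((C - M) * (N + 1) / 2)) with hd
  have hd0 : Tendsto d atTop (𝓝 0) := by
    have h1 : Tendsto (fun N : ℕ => (C - M) * ((N : ℝ) + 1) / 2) atTop atBot := by
      have hneg : (C - M) / 2 < 0 := by linarith
      have : Tendsto (fun N : ℕ => ((N : ℝ) + 1)) atTop atTop :=
        tendsto_atTop_add_const_right _ _ tendsto_natCast_atTop_atTop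
      have h2 := this.atTop_mul_const_of_neg hneg
      refine h2.congr fun N => ?_
      ring
    have h2 : Tendsto (fun N : ℕ => Real.exp ((C - M) * ((N : ℝ) + 1) / 2)) atTop (𝓝 0) :=
      Real.tendsto_exp_atBot.comp h1
    have h3 : Tendsto (fun N : ℕ => ENNReal.ofReal (Real.exp ((C - M) * ((N : ℝ) + 1) / 2))) atTop
        (𝓝 (ENNReal.ofReal 0)) :=
      (ENNReal.continuous_ofReal.tendsto 0).comp h2
    rw [ENNReal.ofReal_zero] at h3
    exact h3
  -- eventually `a N ≤ d N`
  have hle : ∀ᶠ N : ℕ in atTop, a N ≤ d N := by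
    filter_upwards [hb] with N hN
    have hsq : a N ^ 2 ≤ d N ^ 2 := by
      calc a N ^ 2 ≤ ENNReal.ofReal (Real.exp (C * (N + 1))) * b N := hab N
        _ ≤ ENNReal.ofReal (Real.exp (C * (N + 1))) *
              ENNReal.ofReal (Real.exp (-(M * (N + 1)))) := by gcongr
        _ = d N ^ 2 := by
          rw [hd, ← ENNReal.ofReal_mul (Real.exp_pos _).le, ← ENNReal.ofReal_pow (Real.exp_pos _).le,
            ← Real.exp_add, ← Real.exp_nat_mul]
          congr 1
          push_cast
          ring_nf
    exact (ENNReal.pow_le_pow_left_iff two_ne_zero).mp hsq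
  exact tendsto_of_tendsto_of_tendsto_of_le_of_le' tendsto_const_nhds hd0
    (Eventually.of_forall fun N => zero_le) hle

/-- **Transfer of a superexponential bound through an exponential `L²` budget, for measures.**
For two sequences of measures `μ N`, `ν N` on spaces `α N` and events `S N`: if
`μ N (S N)² ≤ e^{C(N+1)} ν N (S N)` for all `N` and, for every `M`, eventually
`ν N (S N) ≤ e^{-M(N+1)}`, then `μ N (S N) → 0`. [cite: KipnisLandim1999, Ch. 10 §5] -/
theorem measure_tendsto_zero_of_transfer {α : ℕ → Type*} [∀ N, MeasurableSpace (α N)]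
    (μ ν : ∀ N, Measure (α N)) (S : ∀ N, Set (α N)) (C : ℝ)
    (hT : ∀ N : ℕ, μ N (S N) ^ 2 ≤ ENNReal.ofReal (Real.exp (C * (N + 1))) * ν N (S N))
    (hν : ∀ M : ℝ, ∀ᶠ N : ℕ in atTop, ν N (S N) ≤ ENNReal.ofReal (Real.exp (-(M * (N + 1))))) :
    Tendsto (fun N => μ N (S N)) atTop (𝓝 0) :=
  ennreal_tendsto_zero_of_sq_le_exp_mul (b := fun N => ν N (S N)) (lt_add_one C) hT (hν (C + 1))

/-- **Finite union bound in the limit.** If finitely many sequences of events are each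
asymptotically negligible under `μ N`, so is their union. [folklore] -/
theorem measure_biUnion_finset_tendsto_zero {α : ℕ → Type*} [∀ N, MeasurableSpace (α N)]
    (μ : ∀ N, Measure (α N)) {ι : Type*} (s : Finset ι) (S : ι → ∀ N, Set (α N))
    (h : ∀ i ∈ s, Tendsto (fun N => μ N (S i N)) atTop (𝓝 0)) :
    Tendsto (fun N => μ N (⋃ i ∈ s, S i N)) atTop (𝓝 0) := by
  have hsum : Tendsto (fun N => ∑ i ∈ s, μ N (S i N)) atTop (𝓝 0) := by
    simpa using tendsto_finsetSum s fun i hi => h i hi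
  refine tendsto_of_tendsto_of_tendsto_of_le_of_le' tendsto_const_nhds hsum
    (Eventually.of_forall fun N => zero_le) (Eventually.of_forall fun N => ?_)
  exact measure_biUnion_finset_le s fun i => S i N

/-- **Events of vanishing probability do not affect convergence in probability.** If
`μ N (B N) → 0` and `μ N (A N \ B N) → 0` then `μ N (A N) → 0`. [folklore] -/
theorem measure_tendsto_zero_of_diff {α : ℕ → Type*} [∀ N, MeasurableSpace (α N)]
    (μ : ∀ N, Measure (α N)) (A B : ∀ N, Set (α N))
    (hB : Tendsto (fun N => μ N (B N)) atTop (𝓝 0))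
    (hAB : Tendsto (fun N => μ N (A N \ B N)) atTop (𝓝 0)) :
    Tendsto (fun N => μ N (A N)) atTop (𝓝 0) := by
  have hsum : Tendsto (fun N => μ N (A N \ B N) + μ N (B N)) atTop (𝓝 0) := by
    simpa using hAB.add hB
  refine tendsto_of_tendsto_of_tendsto_of_le_of_le' tendsto_const_nhds hsum
    (Eventually.of_forall fun N => zero_le) (Eventually.of_forall fun N => ?_)
  calc μ N (A N) ≤ μ N ((A N \ B N) ∪ B N) := measure_mono (by
          intro z hz; by_cases hzB : z ∈ B N
          · exact Or.inr hzB
          · exact Or.inl ⟨hz, hzB⟩)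
    _ ≤ μ N (A N \ B N) + μ N (B N) := measure_union_le _ _

/-- **The route's transfer step** (vocabulary of `SuperextensiveClosureCost`): under the inlined
`TransferInequality` budget at fixed `σ` — one constant `C` with
`localGibbsLaw σ a₀ u₀ θ₀ N Φ S ² ≤ e^{C(N+1)} · localGibbsLaw σ 1 0 θe N Φ S` for all `N`, `Φ`, `S` —
any family of events `S N` whose homogeneous-Gibbs probability is eventually `≤ e^{-M(N+1)}` for
every `M` (the conclusion shape of `MomentumClosureCost` / `EnergyClosureCost`) has local-Gibbs
probability tending to `0`. [cite: KipnisLandim1999, Ch. 10 §5] -/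
theorem localGibbsLaw_tendsto_zero_of_transfer {σ θe C : ℝ} {a₀ θ₀ : T3 → ℝ} {u₀ : T3 → V3}
    (Φ : (N : ℕ) → HardSphereFlow (Torus.geometry (Fin 3)) (hsDiameter σ N) (N + 1))
    (S : (N : ℕ) → Set (Config (N + 1) (Fin 3) T3))
    (hT : ∀ (N : ℕ) (Ψ : HardSphereFlow (Torus.geometry (Fin 3)) (hsDiameter σ N) (N + 1))
      (A : Set (Config (N + 1) (Fin 3) T3)),
      localGibbsLaw σ a₀ u₀ θ₀ N Ψ A ^ 2 ≤
        ENNReal.ofReal (Real.exp (C * (N + 1))) *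
          localGibbsLaw σ (fun _ => 1) (fun _ => 0) (fun _ => θe) N Ψ A)
    (hS : ∀ M : ℝ, ∀ᶠ N : ℕ in atTop,
      localGibbsLaw σ (fun _ => 1) (fun _ => 0) (fun _ => θe) N (Φ N) (S N) ≤
        ENNReal.ofReal (Real.exp (-(M * (N + 1))))) :
    Tendsto (fun N => localGibbsLaw σ a₀ u₀ θ₀ N (Φ N) (S N)) atTop (𝓝 0) :=
  measure_tendsto_zero_of_transfer (fun N => localGibbsLaw σ a₀ u₀ θ₀ N (Φ N))
    (fun N => localGibbsLaw σ (fun _ => 1) (fun _ => 0) (fun _ => θe) N (Φ N)) S C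
    (fun N => hT N (Φ N) (S N)) hS

end Summit.AtomisticToContinuum.HydrodynamicLimit.Theorems

end
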